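import Summits.QuantumFields.YangMills.Theorems.BalabanUVNodesN07SectBExpansionAtObjects

/-!
# BalabanUVNodes ∕ N07 — [Balaban1985Variational] Sect. B (26) ∕ (29)–(31): THE THIRD-ORDER REMAINDER `ρ_p` OF THE EXPANSION OF THE ACTION OF RECORD AT AN `SU(N)`
# BACKGROUND — pv27's bound `norm_rem3_le` with its unitary arguments DISCHARGED (`‖U(∂p)‖ = ‖U(∂p)⁻¹‖ = 1` at every `SU(N)` configuration of record)

Track A node N07, cell `pub-ymgap`; width seat `pub-ymgap-dag-n07-w1` (g0), S1 follow-up (e) (dag-lead g14 DEDUP-366 (4): GO at 01:50Z absent the lane's word).  NEW leaf over this seat's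
`…N07SectBExpansionAtObjects` (p589486); CONSUMED BY NAME: pv27 `B9Eq39Adjoint.norm_rem3_le ∕ rem3 ∕ plaqU ∕ lettersA`, `Beta.TransportVertices.expTail ∕ size`, Mathlib `CStarRing.norm_of_mem_unitary`.
`--kind proof --supports stmt-QuantumFields-20542 --as helper` (K1⁷; count-neutral).  THEOREMS ONLY.
* `plaqU_cfgGL_mem_unitary`, `norm_coe_plaqU_cfgGL`, `norm_coe_plaqU_cfgGL_inv` — pv27's plaquette unit at the datum of record is unitary, of norm one (operator norm), and so is its inverse.
* ★ `norm_rem3_cfgGL_le` — `‖ρ_p‖ ≤ ‖τ‖ · expTail 3 (|η| · Σ_{b⊂∂p} ‖A′(b)‖)` for every continuous tracial reading `τ` (in particular `τ_N`): the remainder of (26) ∕ `wilsonAction4_expChart_expansion`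
  is THIRD ORDER in `η·A` with print's entire-function tail ([15] (31) «|V₄(A,∂p)| ≤ (|A|(∂p))⁴e^{η|A|(∂p)}» is the same mechanism one order up).
HONEST FRAMING: bookkeeping; the norm of `τ` is left symbolic (no claim `‖τ_N‖ ≤ 1` here); nothing of Bałaban asserted; N07 NOT discharged; K1⁷ NOT closed; counts unmoved (28∕28 · 5∕27);
one finite 𝕋⁴ programme at fixed ε — NOT continuum ∕ ℝ⁴ ∕ OS ∕ mass gap ∕ Clay.  0 def, 0 sorry.
-/

noncomputable section

namespace Summit.QuantumFields.YangMills.BalabanUVNodes.N07SectBRemainderAtObjects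

open Literature.MathematicalPhysics.QuantumFieldTheory.Balaban1983to89
open Literature.MathematicalPhysics.QuantumFieldTheory.Balaban1983to89.Node00
open B9Eq39Adjoint (plaqU rem3 lettersA)
open B9TorusCalculus (torusT)
open B12Eq18Current (dirForm)
open Beta.TransportVertices (expTail size)
open Summit.QuantumFields.YangMills.BalabanUVNodes.N07SectBExpansionAtObjects (plaqU_torusT_cfgGL_inv_eq_star)
open scoped Matrix.Norms.L2Operator

variable {N : ℕ} [NeZero N] {P : Params} {j : ℕ}

omit [NeZero N] in
/-- pv27's plaquette unit at the datum of record is a unitary matrix (`U(∂p)⁻¹ = U(∂p)*`). [cite: Balaban1985BackgroundPropagators, (3.5) p.391 (bookkeeping)] -/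
theorem plaqU_cfgGL_mem_unitary (U : GaugeField P j (SU N)) (μ ν : Fin P.d) (x : Site P j) :
    ((plaqU (torusT P j) (dirForm (cfgGL N U)) μ ν x : (Matrix (Fin N) (Fin N) ℂ)ˣ) : Matrix (Fin N) (Fin N) ℂ) ∈ unitary (Matrix (Fin N) (Fin N) ℂ) := by
  have h := plaqU_torusT_cfgGL_inv_eq_star U μ ν x
  refine Unitary.mem_iff.mpr ⟨?_, ?_⟩
  · rw [← h, ← Units.val_mul, inv_mul_cancel, Units.val_one]
  · rw [← h, ← Units.val_mul, mul_inv_cancel, Units.val_one]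

/-- **`‖U(∂p)‖ = 1`** (operator norm) at every `SU(N)` configuration of record, `N ≥ 1`. [cite: Balaban1985BackgroundPropagators, (3.5) p.391 (bookkeeping)] -/
theorem norm_coe_plaqU_cfgGL (U : GaugeField P j (SU N)) (μ ν : Fin P.d) (x : Site P j) :
    ‖((plaqU (torusT P j) (dirForm (cfgGL N U)) μ ν x : (Matrix (Fin N) (Fin N) ℂ)ˣ) : Matrix (Fin N) (Fin N) ℂ)‖ = 1 :=
  CStarRing.norm_of_mem_unitary (plaqU_cfgGL_mem_unitary U μ ν x)

/-- **`‖U(∂p)⁻¹‖ = 1`** likewise (`U(∂p)⁻¹ = U(∂p)*`, `‖X*‖ = ‖X‖`). [cite: Balaban1985BackgroundPropagators, (3.5) p.391 (bookkeeping)] -/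
theorem norm_coe_plaqU_cfgGL_inv (U : GaugeField P j (SU N)) (μ ν : Fin P.d) (x : Site P j) :
    ‖(((plaqU (torusT P j) (dirForm (cfgGL N U)) μ ν x)⁻¹ : (Matrix (Fin N) (Fin N) ℂ)ˣ) : Matrix (Fin N) (Fin N) ℂ)‖ = 1 := by
  rw [plaqU_torusT_cfgGL_inv_eq_star, norm_star, norm_coe_plaqU_cfgGL]

/-- ★ **THE THIRD-ORDER REMAINDER OF (26) AT AN `SU(N)` BACKGROUND OF RECORD**: for every continuous tracial reading `τ` (e.g. `τ_N`), every `η`, bond field `A` and plaquette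
`p_{μν}(x)`, `‖ρ_p‖ ≤ ‖τ‖ · expTail 3 (|η| · Σ_{b⊂∂p}‖A′(b)‖)` — pv27's `norm_rem3_le` with `‖U(∂p)‖ + ‖U(∂p)⁻¹‖ = 2` discharged (`expTail 3 t = e^t − 1 − t − t²∕2`, third order;
`size (lettersA …)` the sum of the norms of the four transported letters `A′(b)`, [5] (3.2)). [cite: Balaban1985Variational, (26) p.282, (29)–(31) p.282; Balaban1985BackgroundPropagators, (3.12) p.392] -/
theorem norm_rem3_cfgGL_le (τ : Matrix (Fin N) (Fin N) ℂ →L[ℂ] ℂ) (η : ℝ) (U₀ : GaugeField P j (SU N)) (A : Fin P.d → Site P j → Matrix (Fin N) (Fin N) ℂ)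
    (μ ν : Fin P.d) (x : Site P j) :
    ‖rem3 (torusT P j) (dirForm (cfgGL N U₀)) η (τ : Matrix (Fin N) (Fin N) ℂ →ₗ[ℂ] ℂ) A μ ν x‖ ≤
      ‖τ‖ * expTail 3 (|η| * size (lettersA (torusT P j) (dirForm (cfgGL N U₀)) A μ ν x)) := by
  have h := B9Eq39Adjoint.norm_rem3_le (torusT P j) (dirForm (cfgGL N U₀)) τ η A μ ν x
  rw [norm_coe_plaqU_cfgGL, norm_coe_plaqU_cfgGL_inv] at h
  calc _ ≤ 2⁻¹ * ‖τ‖ * (1 + 1) * expTail 3 (|η| * size (lettersA (torusT P j) (dirForm (cfgGL N U₀)) A μ ν x)) := h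
    _ = ‖τ‖ * expTail 3 (|η| * size (lettersA (torusT P j) (dirForm (cfgGL N U₀)) A μ ν x)) := by ring

end Summit.QuantumFields.YangMills.BalabanUVNodes.N07SectBRemainderAtObjects

end
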